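import Literature.AlgebraicGeometry.HodgeTheory.HypersurfaceHolomorphicForms
import Literature.NumberTheory.Transcendental.FormIntegrationStokes
import Literature.NumberTheory.Transcendental.ComplexFormsTopType
import Literature.NumberTheory.Transcendental.FormsAlgebraWedgeProofs
import Literature.NumberTheory.Transcendental.KaehlerHodgeOfRealProofs
import Literature.Geometry.Kaehler.ManifoldFormsChart
import Mathlib.RingTheory.Norm.Transitivity
import Mathlib.RingTheory.Complex
import HarnessLib

/-!
# Non-zero holomorphic top forms are not exact (Voisin I, Cor. 7.6, `p = n`) — proof

Sibling proofs file of `HypersurfaceHolomorphicForms.lean` (family `hodge`, layer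
`Literature/AlgebraicGeometry/HodgeTheory`), discharging its named fact

| named fact                                                                        | discharged by                                     |
|-----------------------------------------------------------------------------------|---------------------------------------------------|
| `Literature.AlgebraicGeometry.HodgeTheory.Voisin2002_closedForm_top_zero_not_exact E M` | `Voisin2002_closedForm_top_zero_not_exact_holds E M` |

(Voisin (2002), Cor. 7.6 with Prop. 7.5, case `p = n`: on a compact Kähler — here merely compact
complex — manifold `M` of dimension `n`, a non-zero smooth closed complex `n`-form of type `(n,0)` is
not in `B^n(M; ℂ) = cexactSmoothForms E M n`). Voisin's printed proof of the case `p = k` of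
Prop. 7.5 goes through the `∂∂̄`-lemma (harmonic theory); as announced in the fact's docstring we
give instead the elementary proof by integration, `∫_M i^{n²} η ∧ η̄ > 0` versus Stokes, on the tree's
carriers (`MForm.integral` of `FormIntegration.lean`, Stokes =
`MForm.integral_eq_zero_of_mem_exactSmoothForms_holds` of `FormIntegrationStokes.lean`).

## Main statements (all proved)

* `exists_eq_mextDeriv_of_mem_cexactSmoothForms`: a complex exact smooth form is `dβ`, `β` smooth.
* `re_mextDeriv_mem_exactSmoothForms`: `Re (dγ)` is an exact real form (`γ` smooth), from the
  discharged fact `MForm.re_mextDeriv` (`KaehlerHodgeOfRealProofs`).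
* `det_tangentCoordChange_self_pos`: **transition Jacobians of a complex manifold have positive
  determinant** (`det_ℝ = |det_ℂ|²`, Mathlib's `LinearMap.det_restrictScalars` and
  `Algebra.norm_complex_apply`; the transition maps are holomorphic, `contDiffWithinAt_ext_coord_change`
  for `𝓘(ℂ, E)`), whence `isContinuousOrientation_const`: **a complex manifold is oriented by any
  fixed orientation of its model space** (the constant family, every tangent space being the model
  space) in the sense of `IsContinuousOrientation` (Huybrechts (2005), Cor. 1.2.3).
* `integral_pos_of_chartIntegrand_nonneg`: a smooth top form whose chart integrands (in the defining
  formula of `MForm.integral`) are `≥ 0`, and `> 0` at one point, has positive integral.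
* `IsOfType.apply_eq_smul_cdetL`: bridge from `IsOfType n 0` to `eq_smul_cdetL_of_weight`
  (`ComplexFormsTopType`): pointwise `η = η(e) · det_e`.
* `Voisin2002_closedForm_top_zero_not_exact_holds`.

## Proof of the fact

Let `η = dβ` be smooth, closed, of type `(n,0)`, `n = m + 1` (for `n = 0`, `B^0 = 0`). Put
`Ω = Re(c₀ · η ∧ η̄)`, a smooth real `2n`-form (`IsSmoothFormWedge_holds`), `c₀ = \overline{(-2i)^n}`.
(1) `Ω` is exact: `d(β ∧ η̄) = dβ ∧ η̄ ± β ∧ dη̄ = η ∧ η̄` by the Leibniz rule `MextDerivWedge_holds`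
(`FormsAlgebraWedgeProofs`) and `dη̄ = \overline{dη} = 0` (`mextDeriv_conj_holds`); `d` is `ℂ`-linear
(`mextDeriv_smul_complex_holds`) and commutes with `Re`; so `∫_M Ω = 0` by Stokes for the constant
orientation `o₀ = [ψ₀]`. (2) Pointwise `η_x = η_x(e) det_e` for a complex basis `e` of `E`
(`IsOfType.apply_eq_smul_cdetL`), so `Ω_x = |η_x(e)|² ψ₀` with `ψ₀ = Re(c₀ det_e ∧ \overline{det_e})`,
`ψ₀(e, ie) = 4^n > 0` (`ComplexFormsTopType`). (3) In the formula
`∫_M Ω = ∑ᶠᵢ ∫_{targetᵢ} chartSign · ρᵢ ∘ chart⁻¹ · Ω̂ᵢ(e₁, …, e_{2n})`, at a target point `y` with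
`A_y` the derivative of the inverse chart read in the chart at the image point `z`:
`chartSign = sign(det A_y · r ψ₀(e_•)) = sign ψ₀(e_•)` (`det A_y > 0`, `r > 0`) and
`Ω̂ᵢ(y)(e_•) = det A_y · |η_z(e)|² ψ₀(e_•)`, so the integrand is `ρᵢ(z) det A_y |η_z(e)|² |ψ₀(e_•)| ≥ 0`,
and `> 0` at `y = chartᵢ(x₀)` for `η_{x₀} ≠ 0` and `ρᵢ(x₀) > 0`; hence `∫_M Ω > 0`, contradiction.

## References

* C. Voisin, *Hodge Theory and Complex Algebraic Geometry I*, Cambridge Stud. Adv. Math. 76 (2002),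
  Prop. 7.5, Cor. 7.6 (PDF pp. 132–133 of the held copy), §2.3.1.
* D. Huybrechts, *Complex Geometry*, Universitext (2005), Cor. 1.2.3 (complex structure ⇒ orientation).
* J. M. Lee, *Introduction to Smooth Manifolds*, 2nd ed. (2013), Prop. 15.6, Prop. 16.5–16.6, Thm. 16.11.
-/

noncomputable section

open scoped Manifold ContDiff Topology
open Set Function Filter MeasureTheory Module

namespace Literature.AlgebraicGeometry.HodgeTheory

/-! ### Real parts of complex forms: exactness -/

section ReForm

variable {E : Type*} [NormedAddCommGroup E] [NormedSpace ℂ E]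
  {M : Type*} [TopologicalSpace M] [ChartedSpace E M] {k : ℕ}

/-- Real part commutes with degree casts (definitional). [folklore] -/
theorem re_castDeg {k' : ℕ} (h : k = k') (γ : Literature.Geometry.Kaehler.MForm 𝓘(ℝ, E) M ℂ k) :
    (γ.castDeg h).re = γ.re.castDeg h :=
  rfl

/-- The real part of the exterior derivative of a smooth complex form is an exact real form
(`Re (dγ) = d (Re γ)`, the discharged named fact `MForm.re_mextDeriv`). [folklore] -/
theorem re_mextDeriv_mem_exactSmoothForms {γ : Literature.Geometry.Kaehler.MForm 𝓘(ℝ, E) M ℂ k}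
    (hγ : Literature.Geometry.Kaehler.IsSmoothForm γ) :
    (Literature.Geometry.Kaehler.mextDeriv γ).re ∈
      Literature.Geometry.Kaehler.exactSmoothForms 𝓘(ℝ, E) M ℝ (k + 1) := by
  rw [Literature.Geometry.Kaehler.MForm.re_mextDeriv_holds hγ]
  exact Submodule.subset_span ⟨γ.re, hγ.re, rfl⟩

end ReForm

/-! ### Complex exact forms are derivatives of smooth forms -/

section ComplexExact

variable {E : Type*} [NormedAddCommGroup E] [NormedSpace ℂ E]
  {M : Type*} [TopologicalSpace M] [ChartedSpace E M] {m : ℕ}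

/-- **An exact smooth complex form is `dβ` for a smooth complex form `β`**: the `ℂ`-span in the
definition of `cexactSmoothForms E M (m+1)` adds nothing, `d` being additive on smooth forms and
`ℂ`-linear (`mextDeriv_smul_complex_holds`). [folklore] -/
theorem exists_eq_mextDeriv_of_mem_cexactSmoothForms
    {η : Literature.Geometry.Kaehler.MForm 𝓘(ℝ, E) M ℂ (m + 1)}
    (hη : η ∈ Literature.NumberTheory.Transcendental.cexactSmoothForms E M (m + 1)) :
    ∃ β : Literature.Geometry.Kaehler.MForm 𝓘(ℝ, E) M ℂ m,
      Literature.Geometry.Kaehler.IsSmoothForm β ∧ η = Literature.Geometry.Kaehler.mextDeriv β := by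
  change η ∈ Submodule.span ℂ _ at hη
  induction hη using Submodule.span_induction with
  | mem x hx =>
    obtain ⟨β, hβ, rfl⟩ := hx
    exact ⟨β, (Literature.NumberTheory.Transcendental.mem_csmoothForms_iff β).1 hβ, rfl⟩
  | zero => exact ⟨0, Literature.Geometry.Kaehler.isSmoothForm_zero, Literature.Geometry.Kaehler.mextDeriv_zero.symm⟩
  | add x y _ _ hx hy =>
    obtain ⟨β, hβ, rfl⟩ := hx
    obtain ⟨γ, hγ, rfl⟩ := hy
    exact ⟨β + γ, hβ.add hγ, (Literature.Geometry.Kaehler.mextDeriv_add hβ hγ).symm⟩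
  | smul c x _ hx =>
    obtain ⟨β, hβ, rfl⟩ := hx
    exact ⟨c • β, hβ.smul_complex c,
      (Literature.NumberTheory.Transcendental.mextDeriv_smul_complex_holds c β).symm⟩

end ComplexExact

/-! ### Complex manifolds are oriented by any fixed orientation of the model space -/

section ComplexOrientation

variable {E : Type*} [NormedAddCommGroup E] [NormedSpace ℂ E] [FiniteDimensional ℂ E]
  {M : Type*} [TopologicalSpace M] [ChartedSpace E M]
  [IsManifold 𝓘(ℂ, E) ω M] [IsManifold 𝓘(ℝ, E) ∞ M]

omit [FiniteDimensional ℂ E] [IsManifold 𝓘(ℂ, E) ω M] [IsManifold 𝓘(ℝ, E) ∞ M] in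
/-- The real and complex extended charts of a complex manifold coincide (both model with corners
are the identity of `E`). [folklore] -/
theorem extChartAt_complex_eq (p : M) : extChartAt 𝓘(ℂ, E) p = extChartAt 𝓘(ℝ, E) p := rfl

/-- **The transition Jacobians of a complex manifold have positive determinant**: for `x` in the
source of the (real) extended chart at `p`, the tangent coordinate change from the chart at `p` to
the chart at `x`, taken at `x` — the real derivative of the transition map — is the real map
underlying a `ℂ`-linear automorphism (the complex derivative of the holomorphic transition map,
`contDiffWithinAt_ext_coord_change` for `𝓘(ℂ, E)`), so its determinant is `|det_ℂ|² > 0`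
(`LinearMap.det_restrictScalars`, `Algebra.norm_complex_apply`; nonvanishing by the cocycle identity,
`det_tangentCoordChange_ne_zero`). This is "every complex manifold is orientable" (Huybrechts (2005),
Cor. 1.2.3; Boggess (1991), §2.5: `det DF = |det ∂F/∂z|²`), cf.
`Literature.Topology.FourManifolds.det_restrictScalars_eq_normSq`. [folklore] -/
theorem det_tangentCoordChange_self_pos (p : M) {x : M} (hx : x ∈ (extChartAt 𝓘(ℝ, E) p).source) :
    0 < LinearMap.det (tangentCoordChange 𝓘(ℝ, E) p x x : E →ₗ[ℝ] E) := by
  refine lt_of_le_of_ne ?_ (Literature.NumberTheory.Transcendental.det_tangentCoordChange_ne_zero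
    hx (mem_extChartAt_source x)).symm
  set y : E := extChartAt 𝓘(ℝ, E) p x with hy
  have hyt : y ∈ (extChartAt 𝓘(ℝ, E) p).target := (extChartAt 𝓘(ℝ, E) p).map_source hx
  -- the transition map is holomorphic, so its real derivative is complex-linear
  set T : E → E := extChartAt 𝓘(ℝ, E) x ∘ (extChartAt 𝓘(ℝ, E) p).symm with hT
  have hTy : y ∈ ((extChartAt 𝓘(ℂ, E) p).symm ≫ extChartAt 𝓘(ℂ, E) x).source := by
    rw [extChartAt_complex_eq, extChartAt_complex_eq, PartialEquiv.trans_source,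
      PartialEquiv.symm_source]
    refine ⟨hyt, ?_⟩
    rw [mem_preimage, hy, (extChartAt 𝓘(ℝ, E) p).left_inv hx]
    exact mem_extChartAt_source x
  have hC : ContDiffWithinAt ℂ ω T (range 𝓘(ℂ, E)) y := by
    have := contDiffWithinAt_ext_coord_change (I := 𝓘(ℂ, E)) (n := ω) x p hTy
    rwa [extChartAt_complex_eq, extChartAt_complex_eq] at this
  rw [ModelWithCorners.range_eq_univ, contDiffWithinAt_univ] at hC
  have hD : HasFDerivAt T (fderiv ℂ T y) y := (hC.differentiableAt (by simp)).hasFDerivAt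
  have hDR : fderiv ℝ T y = (fderiv ℂ T y).restrictScalars ℝ := (hD.restrictScalars ℝ).fderiv
  have hcoord : tangentCoordChange 𝓘(ℝ, E) p x x = fderiv ℝ T y := by
    rw [tangentCoordChange_def, ModelWithCorners.range_eq_univ, fderivWithin_univ]
  rw [hcoord, hDR]
  change 0 ≤ LinearMap.det ((fderiv ℂ T y : E →ₗ[ℂ] E).restrictScalars ℝ)
  rw [LinearMap.det_restrictScalars, Algebra.norm_complex_apply]
  exact Complex.normSq_nonneg _

variable {N : ℕ} [Fact (finrank ℝ E = N)]

omit [FiniteDimensional ℂ E] in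
/-- A nonzero top-degree alternating form does not vanish on a basis. [folklore] -/
theorem apply_basis_ne_zero_of_ne_zero {ι : Type*} [Fintype ι] [DecidableEq ι] (b : Basis ι ℝ E)
    {w : E [⋀^ι]→ₗ[ℝ] ℝ} (hw : w ≠ 0) : w b ≠ 0 := fun h ↦ hw (by
  rw [AlternatingMap.eq_smul_basis_det b w, h, zero_smul])

/-- **The chart signs of a constant orientation family** `x ↦ o₀` on a complex manifold (possible
since every tangent space of `M` *is* the model space `E`) are the constant
`sign (o₀.someVector (e₁, …, e_N))` at every chart point (`chartSign_extChartAt` and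
`det_tangentCoordChange_self_pos`). [folklore] -/
theorem chartSign_const_extChartAt (o₀ : Orientation ℝ E (Fin N)) {p x : M}
    (hx : x ∈ (extChartAt 𝓘(ℝ, E) p).source) :
    Literature.NumberTheory.Transcendental.chartSign (I := 𝓘(ℝ, E)) (M := M) (fun _ ↦ o₀) p
        (extChartAt 𝓘(ℝ, E) p x) =
      Real.sign (o₀.someVector (Literature.NumberTheory.Transcendental.modelBasis E N)) := by
  rw [Literature.NumberTheory.Transcendental.chartSign_extChartAt (fun _ ↦ o₀) hx,
    Real.sign_of_pos (det_tangentCoordChange_self_pos p hx), one_mul]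
  rfl

/-- **A complex manifold is oriented by any fixed orientation `o₀` of its model space**: the constant
family `x ↦ o₀` is a continuous orientation in the sense of `IsContinuousOrientation` (chart signs
are constant `= sign (o₀.someVector (e_•)) ≠ 0` on every chart target). Huybrechts (2005),
Cor. 1.2.3; used tacitly in Voisin (2002), Ch. 7. [folklore] -/
theorem isContinuousOrientation_const (o₀ : Orientation ℝ E (Fin N)) :
    Literature.NumberTheory.Transcendental.IsContinuousOrientation (I := 𝓘(ℝ, E)) (M := M)
      (fun _ ↦ o₀) := by
  intro p
  have hs₀ : o₀.someVector (Literature.NumberTheory.Transcendental.modelBasis E N) ≠ 0 :=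
    apply_basis_ne_zero_of_ne_zero _ (Module.Ray.someVector_ne_zero o₀)
  filter_upwards [extChartAt_target_mem_nhdsWithin (I := 𝓘(ℝ, E)) p] with y hy
  have hz : (extChartAt 𝓘(ℝ, E) p).symm y ∈ (extChartAt 𝓘(ℝ, E) p).source :=
    (extChartAt 𝓘(ℝ, E) p).map_target hy
  rw [← (extChartAt 𝓘(ℝ, E) p).right_inv hy, chartSign_const_extChartAt o₀ hz,
    chartSign_const_extChartAt o₀ (mem_extChartAt_source p)]
  exact ⟨rfl, Real.sign_eq_zero_iff.not.2 hs₀⟩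

end ComplexOrientation

/-! ### Positivity of the integral of a top form with nonnegative chart integrands -/

section IntegralPos

variable {E : Type*} [NormedAddCommGroup E] [NormedSpace ℝ E] [FiniteDimensional ℝ E]
  {n : ℕ} [Fact (finrank ℝ E = n)]
  {H : Type*} [TopologicalSpace H] {I : ModelWithCorners ℝ E H}
  {M : Type*} [TopologicalSpace M] [ChartedSpace H M] [IsManifold I ∞ M] [I.Boundaryless]
  {o : (x : M) → Orientation ℝ (TangentSpace I x) (Fin n)}
  [MeasurableSpace E] [BorelSpace E] [T2Space M] [SigmaCompactSpace M] [CompactSpace M]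

/-- **A top form whose chart integrands are nonnegative, and positive somewhere, has positive
integral.** In the definition of `∫_M α` (`MForm.integral`: a finite sum over the chosen partition
of unity of integrals over chart targets of `chartSign · ρᵢ ∘ chart⁻¹ · α̂ᵢ(e₁, …, eₙ)`), if every
chart integrand is `≥ 0` on its chart target and one of them is `> 0` at one point of its target,
then `0 < ∫_M α`: the integrands are continuous on the (open) targets, so the positive one is
positive on an open set of positive Lebesgue measure. Lee (2013), Prop. 16.6(c) (positivity of
`∫_M` for positively oriented forms), in the chart-integrand form needed here. [folklore] -/
theorem integral_pos_of_chartIntegrand_nonneg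
    (ho : Literature.NumberTheory.Transcendental.IsContinuousOrientation o)
    {α : Literature.Geometry.Kaehler.MForm I M ℝ n} (hα : Literature.Geometry.Kaehler.IsSmoothForm α)
    (hnn : ∀ (i : M), ∀ y ∈ (extChartAt I i).target,
      0 ≤ Literature.NumberTheory.Transcendental.chartSign o i y *
        Literature.NumberTheory.Transcendental.chartPartitionOfUnity I M i ((extChartAt I i).symm y) *
          α.inChart i y (Literature.NumberTheory.Transcendental.modelBasis E n))
    (hpos : ∃ (i : M), ∃ y ∈ (extChartAt I i).target,
      0 < Literature.NumberTheory.Transcendental.chartSign o i y *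
        Literature.NumberTheory.Transcendental.chartPartitionOfUnity I M i ((extChartAt I i).symm y) *
          α.inChart i y (Literature.NumberTheory.Transcendental.modelBasis E n)) :
    0 < α.integral o := by
  obtain ⟨i₀, y₀, hy₀, hg₀⟩ := hpos
  set g : M → E → ℝ := fun i y ↦ Literature.NumberTheory.Transcendental.chartSign o i y *
    Literature.NumberTheory.Transcendental.chartPartitionOfUnity I M i ((extChartAt I i).symm y) *
      α.inChart i y (Literature.NumberTheory.Transcendental.modelBasis E n) with hg
  set μ : Measure E := (Literature.NumberTheory.Transcendental.modelBasis E n).addHaar with hμ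
  have hcont : ∀ i, ContinuousOn (g i) (extChartAt I i).target := fun i ↦
    ((ho.continuousOn_chartSign i).mul
      ((map_continuous (Literature.NumberTheory.Transcendental.chartPartitionOfUnity I M i)).comp_continuousOn
        (continuousOn_extChartAt_symm i))).mul
      (hα.continuousOn_inChart_apply_modelBasis i)
  have hInn : ∀ i, 0 ≤ ∫ y in (extChartAt I i).target, g i y ∂μ := fun i ↦
    setIntegral_nonneg (Literature.NumberTheory.Transcendental.measurableSet_extChartAt_target i)
      (hnn i)
  have hI₀ : 0 < ∫ y in (extChartAt I i₀).target, g i₀ y ∂μ := by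
    rw [setIntegral_pos_iff_support_of_nonneg_ae
      ((ae_restrict_iff' (Literature.NumberTheory.Transcendental.measurableSet_extChartAt_target
        i₀)).2 (Eventually.of_forall (hnn i₀)))
      (Literature.NumberTheory.Transcendental.integrableOn_chartIntegrand ho hα i₀)]
    have hopen : IsOpen ((extChartAt I i₀).target ∩ g i₀ ⁻¹' Ioi 0) :=
      (hcont i₀).isOpen_inter_preimage (isOpen_extChartAt_target i₀) isOpen_Ioi
    refine lt_of_lt_of_le (hopen.measure_pos μ ⟨y₀, hy₀, hg₀⟩) (measure_mono ?_)
    rintro y ⟨hy, hgy⟩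
    exact ⟨ne_of_gt hgy, hy⟩
  exact lt_of_lt_of_le hI₀ (single_le_finsum i₀
    (Literature.NumberTheory.Transcendental.hasFiniteSupport_chartIntegral o α) hInn)

end IntegralPos

/-! ### Assembly: non-zero holomorphic top forms are not exact -/

section Assembly

variable {E : Type*} [NormedAddCommGroup E] [NormedSpace ℂ E] [FiniteDimensional ℂ E]
  {M : Type*} [TopologicalSpace M] [ChartedSpace E M] {n : ℕ}

/-- Bridge from the type condition `IsOfType n 0` of `ComplexForms.lean` to the weight hypothesis of
`ComplexFormsTopType.lean`: at every point, an `n`-form of type `(n,0)` is `η(e) · det_e` for every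
complex basis `e` (`eq_smul_cdetL_of_weight`). [folklore] -/
theorem _root_.Literature.NumberTheory.Transcendental.IsOfType.apply_eq_smul_cdetL
    {η : Literature.Geometry.Kaehler.MForm 𝓘(ℝ, E) M ℂ n}
    (hη : Literature.NumberTheory.Transcendental.IsOfType n 0 η) (e : Module.Basis (Fin n) ℂ E)
    (x : M) :
    (η x : E [⋀^Fin n]→L[ℝ] ℂ) = (η x e) • Literature.NumberTheory.Transcendental.cdetL e := by
  refine Literature.NumberTheory.Transcendental.eq_smul_cdetL_of_weight _ (fun θ v ↦ ?_) e
  have h := hη.2 x θ v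
  simp only [Literature.NumberTheory.Transcendental.tangentRotate_apply, Nat.cast_zero, sub_zero,
    Int.cast_natCast] at h
  exact h

variable (E M) in
/-- Discharge of the named fact `Voisin2002_closedForm_top_zero_not_exact`: **a non-zero holomorphic
form of top degree on a compact complex manifold is not exact** (Voisin (2002), Cor. 7.6 with
Prop. 7.5, case `p = n`; the Kähler hypothesis of the fact is not used). Proof (the elementary one
recorded in the fact's docstring, `∫_X i^{n²} η ∧ η̄ > 0` and Stokes): if `η = dβ`, the real top form
`Ω = Re(c₀ · η ∧ η̄)` (`c₀ = \overline{(-2i)^n}`) is exact — `η ∧ η̄ = d(β ∧ η̄)` by the Leibniz rule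
(`MextDerivWedge_holds`) and `dη̄ = \overline{dη} = 0` (`mextDeriv_conj_holds`), and `d` is `ℂ`-linear
and commutes with `Re` — so `∫_M Ω = 0` by Stokes on the closed manifold `M`
(`MForm.integral_eq_zero_of_mem_exactSmoothForms_holds`, for the constant orientation of the complex
manifold, `isContinuousOrientation_const`); but pointwise `η = η(e) det_e` (`IsOfType.apply_eq_smul_cdetL`)
so `Ω = |η(e)|² ψ₀` with `ψ₀ = Re(c₀ det_e ∧ \overline{det_e})`, `ψ₀(e, ie) = 4^n > 0`
(`reCLM_wedge_conj_smul_cdetL`, `reCLM_wedge_conj_cdetL_apply_append_pos`), whence every chart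
integrand of `∫_M Ω` is `ρᵢ · det(Jacobian) · |η(e)|² · |ψ₀(e₁,…)| ≥ 0`, positive near a point where
`η ≠ 0`, and `∫_M Ω > 0` (`integral_pos_of_chartIntegrand_nonneg`) — a contradiction.
[cite: VoisinHodgeI2002, Prop. 7.5 and Cor. 7.6 (p = n)] -/
theorem Voisin2002_closedForm_top_zero_not_exact_holds :
    Voisin2002_closedForm_top_zero_not_exact E M := by
  intro _ _ _ _ _ n hn η hηs hηc hηt hη0 hηex
  cases n with
  | zero => exact hη0 ((Submodule.mem_bot ℂ).1 hηex)
  | succ m =>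
  obtain ⟨β, hβ, rfl⟩ := exists_eq_mextDeriv_of_mem_cexactSmoothForms hηex
  classical
  -- measurable structure and real dimension of the model
  letI : MeasurableSpace E := borel E
  haveI : BorelSpace E := ⟨rfl⟩
  haveI hfact : Fact (finrank ℝ E = (m + 1) + (m + 1)) :=
    ⟨by rw [finrank_real_of_complex, hn, two_mul]⟩
  -- notation
  set mb := Literature.NumberTheory.Transcendental.modelBasis E ((m + 1) + (m + 1)) with hmb
  set ρ := Literature.NumberTheory.Transcendental.chartPartitionOfUnity 𝓘(ℝ, E) M with hρ
  have hηs' : Literature.Geometry.Kaehler.IsSmoothForm (Literature.Geometry.Kaehler.mextDeriv β) := hηs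
  have hηcs : Literature.Geometry.Kaehler.IsSmoothForm (Literature.Geometry.Kaehler.mextDeriv β).conj :=
    Literature.NumberTheory.Transcendental.isSmoothForm_conj hηs'
  -- a complex basis, the reference top form `ψ₀ = Re(c₀ det ∧ conj det)` and the orientation
  obtain ⟨e⟩ : Nonempty (Module.Basis (Fin (m + 1)) ℂ E) := ⟨Module.finBasisOfFinrankEq ℂ E hn⟩
  obtain ⟨c₀, hc₀⟩ : ∃ c₀ : ℂ, c₀ = starRingEnd ℂ ((-2 * Complex.I) ^ (m + 1)) := ⟨_, rfl⟩
  obtain ⟨ψ₀, hψ₀⟩ : ∃ ψ₀ : E [⋀^Fin ((m + 1) + (m + 1))]→L[ℝ] ℝ,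
      ψ₀ = Complex.reCLM.compContinuousAlternatingMap
        (c₀ • ((Literature.NumberTheory.Transcendental.cdetL e).wedge
          ((Complex.conjCLE : ℂ →L[ℝ] ℂ).compContinuousAlternatingMap
            (Literature.NumberTheory.Transcendental.cdetL e)))) := ⟨_, rfl⟩
  have hψ₀b₀ : 0 < ψ₀ (Fin.append e (fun j ↦ Complex.I • e j)) := by
    rw [hψ₀, hc₀]
    exact Literature.NumberTheory.Transcendental.reCLM_wedge_conj_cdetL_apply_append_pos e
  have hψ₀ne : ψ₀.toAlternatingMap ≠ 0 := fun h ↦ by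
    have : ψ₀ (Fin.append e (fun j ↦ Complex.I • e j)) = 0 := by
      rw [← ContinuousAlternatingMap.coe_toAlternatingMap, h, AlternatingMap.zero_apply]
    exact hψ₀b₀.ne' this
  have hψ₀mb : ψ₀ mb ≠ 0 := apply_basis_ne_zero_of_ne_zero mb hψ₀ne
  obtain ⟨o₀, ho₀⟩ : ∃ o₀ : Orientation ℝ E (Fin ((m + 1) + (m + 1))),
      o₀ = rayOfNeZero ℝ _ hψ₀ne := ⟨_, rfl⟩
  have ho : Literature.NumberTheory.Transcendental.IsContinuousOrientation (I := 𝓘(ℝ, E)) (M := M)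
      (fun _ ↦ o₀) := isContinuousOrientation_const o₀
  obtain ⟨r, hr, hrψ⟩ : ∃ r : ℝ, 0 < r ∧ o₀.someVector = r • ψ₀.toAlternatingMap :=
    ((ray_eq_iff (Module.Ray.someVector_ne_zero o₀) hψ₀ne).1
      (by rw [Module.Ray.someVector_ray, ho₀])).exists_pos_right
        (Module.Ray.someVector_ne_zero o₀) hψ₀ne
  -- the real top form `Ω = Re(c₀ · η ∧ η̄)`
  obtain ⟨Ω, hΩ⟩ : ∃ Ω : Literature.Geometry.Kaehler.MForm 𝓘(ℝ, E) M ℝ ((m + 1) + (m + 1)),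
      Ω = (c₀ • ((Literature.Geometry.Kaehler.mextDeriv β).wedge
        (Literature.Geometry.Kaehler.mextDeriv β).conj)).re := ⟨_, rfl⟩
  have hΩs : Literature.Geometry.Kaehler.IsSmoothForm Ω := by
    rw [hΩ]
    exact ((Literature.NumberTheory.Transcendental.IsSmoothFormWedge_holds 𝓘(ℝ, E) M ℂ hηs'
      hηcs).smul_complex c₀).re
  -- pointwise: `Ω x = |η x (e)|² ψ₀`
  have hΩx : ∀ (x : M) (v : Fin ((m + 1) + (m + 1)) → E),
      Ω x v = Complex.normSq (Literature.Geometry.Kaehler.mextDeriv β x e) * ψ₀ v := by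
    intro x v
    have hw := hηt.apply_eq_smul_cdetL e x
    have key := congrArg (fun w : E [⋀^Fin ((m + 1) + (m + 1))]→L[ℝ] ℝ ↦ w v)
      (Literature.NumberTheory.Transcendental.reCLM_wedge_conj_smul_cdetL e c₀
        (Literature.Geometry.Kaehler.mextDeriv β x e))
    simp only [ContinuousAlternatingMap.smul_apply, smul_eq_mul] at key
    rw [hΩ, hψ₀]
    refine Eq.trans ?_ key
    exact congrArg (fun φ : E [⋀^Fin (m + 1)]→L[ℝ] ℂ ↦
      (Complex.reCLM.compContinuousAlternatingMap (c₀ • (φ.wedge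
        ((Complex.conjCLE : ℂ →L[ℝ] ℂ).compContinuousAlternatingMap φ)))) v) hw
  -- exactness of `Ω`: Leibniz and `dη̄ = 0`
  have hconj0 : Literature.Geometry.Kaehler.mextDeriv (Literature.Geometry.Kaehler.mextDeriv β).conj = 0 := by
    rw [Literature.NumberTheory.Transcendental.mextDeriv_conj_holds]
    rw [show Literature.Geometry.Kaehler.mextDeriv (Literature.Geometry.Kaehler.mextDeriv β) = 0 from hηc]
    exact Literature.Geometry.Kaehler.MForm.conj_zero
  have hL := Literature.NumberTheory.Transcendental.MextDerivWedge_holds 𝓘(ℝ, E) M ℂ hβ hηcs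
  rw [hconj0, Literature.Geometry.Kaehler.MForm.wedge_zero, smul_zero, add_zero] at hL
  have hΩex : Ω ∈ Literature.Geometry.Kaehler.exactSmoothForms 𝓘(ℝ, E) M ℝ ((m + 1) + (m + 1)) := by
    have h1 : Ω.castDeg (Nat.add_right_comm m 1 (m + 1)) =
        (Literature.Geometry.Kaehler.mextDeriv
          (c₀ • β.wedge (Literature.Geometry.Kaehler.mextDeriv β).conj)).re := by
      rw [Literature.NumberTheory.Transcendental.mextDeriv_smul_complex_holds, hL, hΩ]
      rfl
    have h2 : Ω.castDeg (Nat.add_right_comm m 1 (m + 1)) ∈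
        Literature.Geometry.Kaehler.exactSmoothForms 𝓘(ℝ, E) M ℝ (m + (m + 1) + 1) := by
      rw [h1]
      exact re_mextDeriv_mem_exactSmoothForms
        ((Literature.NumberTheory.Transcendental.IsSmoothFormWedge_holds 𝓘(ℝ, E) M ℂ hβ hηcs).smul_complex
          c₀)
    have h3 := Literature.NumberTheory.Transcendental.castDeg_mem_exactSmoothForms
      (Nat.add_right_comm m 1 (m + 1)).symm h2
    rwa [Literature.Geometry.Kaehler.MForm.castDeg_castDeg, Literature.Geometry.Kaehler.MForm.castDeg_rfl]
      at h3
  -- Stokes: `∫ Ω = 0`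
  have h0 : Ω.integral (fun _ ↦ o₀) = 0 :=
    Literature.Geometry.Kaehler.MForm.integral_eq_zero_of_mem_exactSmoothForms_holds
      (o := fun _ ↦ o₀) ho hΩex
  -- the chart integrands of `∫ Ω`, at the chart point of `z ∈ source`
  have hsv : Real.sign (o₀.someVector mb) = Real.sign (ψ₀ mb) := by
    rw [hrψ, AlternatingMap.smul_apply, ContinuousAlternatingMap.coe_toAlternatingMap, smul_eq_mul,
      Literature.NumberTheory.Transcendental.real_sign_mul, Real.sign_of_pos hr, one_mul]
  have hformula : ∀ (i z : M), z ∈ (extChartAt 𝓘(ℝ, E) i).source →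
      Literature.NumberTheory.Transcendental.chartSign (I := 𝓘(ℝ, E)) (M := M) (fun _ ↦ o₀) i
          (extChartAt 𝓘(ℝ, E) i z) *
        ρ i ((extChartAt 𝓘(ℝ, E) i).symm (extChartAt 𝓘(ℝ, E) i z)) *
          Ω.inChart i (extChartAt 𝓘(ℝ, E) i z) mb =
      ρ i z * LinearMap.det (tangentCoordChange 𝓘(ℝ, E) i z z : E →ₗ[ℝ] E) *
        Complex.normSq (Literature.Geometry.Kaehler.mextDeriv β z e) * |ψ₀ mb| := by
    intro i z hz
    have hin : Ω.inChart i (extChartAt 𝓘(ℝ, E) i z) mb =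
        LinearMap.det (tangentCoordChange 𝓘(ℝ, E) i z z : E →ₗ[ℝ] E) * Ω z mb := by
      rw [Literature.Geometry.Kaehler.MForm.inChart_eq_of_mem_target _
          ((extChartAt 𝓘(ℝ, E) i).map_source hz),
        (extChartAt 𝓘(ℝ, E) i).left_inv hz, ContinuousAlternatingMap.compContinuousLinearMap_apply]
      exact Literature.NumberTheory.Transcendental.ContinuousAlternatingMap.apply_comp_eq_det_mul mb _ _ _
    rw [chartSign_const_extChartAt o₀ hz, hsv, hin, (extChartAt 𝓘(ℝ, E) i).left_inv hz, hΩx z mb,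
      ← Literature.NumberTheory.Transcendental.real_sign_mul_self (ψ₀ mb)]
    ring
  -- positivity: `0 < ∫ Ω`
  have hpos : 0 < Ω.integral (fun _ ↦ o₀) := by
    refine integral_pos_of_chartIntegrand_nonneg ho hΩs (fun i y hy ↦ ?_) ?_
    · have hz : (extChartAt 𝓘(ℝ, E) i).symm y ∈ (extChartAt 𝓘(ℝ, E) i).source :=
        (extChartAt 𝓘(ℝ, E) i).map_target hy
      rw [← (extChartAt 𝓘(ℝ, E) i).right_inv hy, hformula i _ hz]
      exact mul_nonneg (mul_nonneg (mul_nonneg (ρ.nonneg i _)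
        (det_tangentCoordChange_self_pos (M := M) i hz).le) (Complex.normSq_nonneg _)) (abs_nonneg _)
    · obtain ⟨x₀, hx₀⟩ : ∃ x₀, Literature.Geometry.Kaehler.mextDeriv β x₀ ≠ 0 := Function.ne_iff.1 hη0
      have hsum := ρ.sum_eq_one (Set.mem_univ x₀)
      obtain ⟨i₀, hi₀⟩ : ∃ i₀, ρ i₀ x₀ ≠ 0 := by
        by_contra h
        push Not at h
        rw [finsum_congr h, finsum_zero] at hsum
        exact zero_ne_one hsum
      have hρpos : 0 < ρ i₀ x₀ := lt_of_le_of_ne (ρ.nonneg i₀ x₀) (Ne.symm hi₀)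
      have hxs : x₀ ∈ (extChartAt 𝓘(ℝ, E) i₀).source := by
        rw [extChartAt_source]
        exact Literature.NumberTheory.Transcendental.chartPartitionOfUnity_isSubordinate i₀
          (subset_tsupport _ hi₀)
      have hηe : Literature.Geometry.Kaehler.mextDeriv β x₀ e ≠ 0 := by
        intro h0e
        apply hx₀
        have hw := hηt.apply_eq_smul_cdetL e x₀
        rw [h0e] at hw
        exact hw.trans (zero_smul ℂ _)
      refine ⟨i₀, extChartAt 𝓘(ℝ, E) i₀ x₀, (extChartAt 𝓘(ℝ, E) i₀).map_source hxs, ?_⟩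
      rw [hformula i₀ _ hxs]
      exact mul_pos (mul_pos (mul_pos hρpos (det_tangentCoordChange_self_pos (M := M) i₀ hxs))
        (Complex.normSq_pos.2 hηe)) (abs_pos.2 hψ₀mb)
  exact absurd h0 hpos.ne'

end Assembly

end Literature.AlgebraicGeometry.HodgeTheory
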